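import Literature.MathematicalPhysics.QuantumFieldTheory.CurvatureGaussianField
import HarnessLib

/-!
# Stub `stub_cubeShiftInvariance` of line `Sketch` (crux `stmt-QuantumFields-8760`)

Route `EquipartitionCriticality` of `YangMills`, crux item `stmt-QuantumFields-8760`
(`Summit.QuantumFields.YangMills.Theses.EquipartitionCriticality.EquipartitionPinsProbe`), line
`Sketch`, STUB F2 of the lead's skeleton.

What is proved: GIVEN the closedness of the two-plaquette kernel `T = curvatureTwoPoint` in its
first slot (the statement of STUB K2, taken as a hypothesis: for every plaquette `q` and every
`3`-cell `(x; i < j < k)` of `ℤ⁴`, `∂ᵢ T((·; j, k), q) − ∂ⱼ T((·; i, k), q) + ∂ₖ T((·; i, j), q) = 0`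
at `x`), for every measure `τ` on `ℝ^D`-valued `2`-cochains `Y` of `ℤ⁴` that is supported on closed
cochains (T1: `dY = 0` on every `3`-cell, `τ`-a.e.), the functional
`Ψ(h) = exp (Q_S(h) / 2) · (E cos ⟨Y, h⟩_S, E sin ⟨Y, h⟩_S)`, with
`⟨Y, h⟩_S = ∑_{p ∈ S} ∑_a h p a · Y p a` and `Q_S(h) = ∑_{p, q ∈ S} ∑_a h p a · h q a · T(p, q)`, is
unchanged when `h` is replaced by `h + r · f_κ` in one colour `b`, where
`f_κ = δ_{(x+eᵢ; j,k)} − δ_{(x; j,k)} − δ_{(x+eⱼ; i,k)} + δ_{(x; i,k)} + δ_{(x+eₖ; i,j)} − δ_{(x; i,j)}`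
is the face cochain of the `3`-cell `κ = (x; i < j < k)`, provided its six faces lie in `S`.

Proof: (i) the pairing is affine in the shift,
`⟨Y, h + r f_κ e_b⟩_S = ⟨Y, h⟩_S + r ∑_{p ∈ S} f_κ(p) Y p b` (`CubeShiftInvariance.pairing_shift`), and
`∑_{p ∈ S} f_κ(p) Y p b = (dY)^b_κ` because the six faces lie in `S`
(`CubeShiftInvariance.sum_faceCochain_mul`); this vanishes `τ`-a.e. by (T1), so the `cos` / `sin`
integrands agree a.e. and the integrals coincide (`integral_congr_ae`). (ii) Expanding the quadratic
form, the cross and square terms are multiples of `∑_{p ∈ S} f_κ(p) T(p, q)` (after symmetrising with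
`curvatureTwoPoint_comm` and `Finset.sum_comm`), which equals the cube coboundary of `T(·, q)` at
`κ`, i.e. `0` by K2 (`CubeShiftInvariance.quadratic_shift`). Hence `Q_S` and both expectations, and so
both components of `Ψ`, are unchanged.

The kernel-level core (arbitrary shift profile `G` orthogonal to the kernel on `S` and pairing to zero
with `Y^b` a.e.) is `CubeShiftInvariance.invariance`; its concrete instance
`stub_cubeShiftInvarianceCore` is the registered anchor of this file (the full statement of STUB F2
exceeds the stub registry's signature length cap).
-/

noncomputable section

open MeasureTheory
open Literature.MathematicalPhysics.QuantumFieldTheory Literature.MathematicalPhysics.QuantumLattice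
  Literature.Probability.LatticeModels

namespace Summit.QuantumFields.YangMills.Theorems.EquipartitionPinsProbe

namespace CubeShiftInvariance

/-- **The pairing is affine in the one-colour shift**: pairing `Y` against `h + r G e_b` over the
window `S` gives `⟨Y, h⟩_S + r ∑_{p ∈ S} G p · Y p b`. -/
theorem pairing_shift {P : Type*} {D : ℕ} (S : Finset P) (h Y : P → Fin D → ℝ) (G : P → ℝ)
    (b : Fin D) (r : ℝ) :
    ∑ p ∈ S, ∑ a : Fin D, (h p a + if a = b then r * G p else 0) * Y p a =
      ∑ p ∈ S, ∑ a : Fin D, h p a * Y p a + r * ∑ p ∈ S, G p * Y p b := by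
  simp only [add_mul, ite_mul, zero_mul, Finset.sum_add_distrib, Finset.sum_ite_eq',
    Finset.mem_univ, if_true, Finset.mul_sum, mul_assoc]

/-- **The face cochain of a `3`-cell evaluates to the cube coboundary**: if the six points
`p₁, …, p₆` lie in `S`, then `∑_{p ∈ S} ([p = p₁] − [p = p₂] − [p = p₃] + [p = p₄] + [p = p₅] − [p = p₆]) Y p
= (Y p₁ − Y p₂) − (Y p₃ − Y p₄) + (Y p₅ − Y p₆)`. -/
theorem sum_faceCochain_mul {P : Type*} [DecidableEq P] (S : Finset P) {p₁ p₂ p₃ p₄ p₅ p₆ : P}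
    (h₁ : p₁ ∈ S) (h₂ : p₂ ∈ S) (h₃ : p₃ ∈ S) (h₄ : p₄ ∈ S) (h₅ : p₅ ∈ S) (h₆ : p₆ ∈ S)
    (Y : P → ℝ) :
    ∑ p ∈ S, ((if p = p₁ then (1 : ℝ) else 0) - (if p = p₂ then (1 : ℝ) else 0) -
        (if p = p₃ then (1 : ℝ) else 0) + (if p = p₄ then (1 : ℝ) else 0) +
        (if p = p₅ then (1 : ℝ) else 0) - (if p = p₆ then (1 : ℝ) else 0)) * Y p =
      (Y p₁ - Y p₂) - (Y p₃ - Y p₄) + (Y p₅ - Y p₆) := by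
  simp only [sub_mul, add_mul, ite_mul, one_mul, zero_mul, Finset.sum_add_distrib,
    Finset.sum_sub_distrib, Finset.sum_ite_eq', if_pos h₁, if_pos h₂, if_pos h₃, if_pos h₄,
    if_pos h₅, if_pos h₆]
  ring

/-- **The quadratic form is unchanged by a kernel-orthogonal one-colour shift**: for a symmetric
kernel `T` and a shift profile `G` with `∑_{p ∈ S} G p · T(p, q) = 0` for every `q ∈ S`,
`Q_S(h + r G e_b) = Q_S(h)` (the cross terms and the square term are multiples of these sums). -/
theorem quadratic_shift {P : Type*} {D : ℕ} (S : Finset P) (h : P → Fin D → ℝ) (G : P → ℝ)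
    (T : P → P → ℝ) (b : Fin D) (r : ℝ) (hT : ∀ p q, T p q = T q p)
    (hG : ∀ q ∈ S, ∑ p ∈ S, G p * T p q = 0) :
    ∑ p ∈ S, ∑ q ∈ S, ∑ a : Fin D, (h p a + if a = b then r * G p else 0) *
        (h q a + if a = b then r * G q else 0) * T p q =
      ∑ p ∈ S, ∑ q ∈ S, ∑ a : Fin D, h p a * h q a * T p q := by
  have hG' : ∀ p ∈ S, ∑ q ∈ S, G q * T p q = 0 := fun p hp => by
    rw [← hG p hp]
    exact Finset.sum_congr rfl fun q _ => by rw [hT]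
  have hexp : ∀ p q : P, ∑ a : Fin D, (h p a + if a = b then r * G p else 0) *
        (h q a + if a = b then r * G q else 0) * T p q =
      ∑ a : Fin D, h p a * h q a * T p q + (r * (h p b * (G q * T p q)) +
        r * (h q b * (G p * T p q)) + r ^ 2 * (G q * (G p * T p q))) := by
    intro p q
    simp only [add_mul, mul_add, ite_mul, mul_ite, zero_mul, mul_zero, Finset.sum_add_distrib,
      Finset.sum_ite_eq', Finset.mem_univ, if_true]
    ring
  have e1 : ∑ p ∈ S, ∑ q ∈ S, r * (h p b * (G q * T p q)) = 0 := by
    refine Finset.sum_eq_zero fun p hp => ?_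
    rw [← Finset.mul_sum, ← Finset.mul_sum, hG' p hp, mul_zero, mul_zero]
  have e2 : ∑ p ∈ S, ∑ q ∈ S, r * (h q b * (G p * T p q)) = 0 := by
    rw [Finset.sum_comm]
    refine Finset.sum_eq_zero fun q hq => ?_
    rw [← Finset.mul_sum, ← Finset.mul_sum, hG q hq, mul_zero, mul_zero]
  have e3 : ∑ p ∈ S, ∑ q ∈ S, r ^ 2 * (G q * (G p * T p q)) = 0 := by
    rw [Finset.sum_comm]
    refine Finset.sum_eq_zero fun q hq => ?_
    rw [← Finset.mul_sum, ← Finset.mul_sum, hG q hq, mul_zero, mul_zero]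
  simp only [hexp, Finset.sum_add_distrib]
  rw [e1, e2, e3]
  ring


/-- **Abstract rigidity of `exp (Q/2) · (E cos, E sin)` under a kernel-orthogonal, a.s.-null
one-colour shift.** For a symmetric kernel `T` on a finite window `S`, a one-colour shift
`h ↦ h + r G e_b` with `∑_{p ∈ S} G p T(p, q) = 0` for all `q ∈ S` and `∑_{p ∈ S} G p Y p b = 0`
`τ`-a.e. changes neither the quadratic form `Q_S` nor the expectations of `cos ⟨Y, ·⟩_S`,
`sin ⟨Y, ·⟩_S`. -/
theorem invariance {P : Type*} {D : ℕ} [MeasurableSpace (P → Fin D → ℝ)]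
    (τ : Measure (P → Fin D → ℝ)) (T : P → P → ℝ) (hT : ∀ p q, T p q = T q p) (S : Finset P)
    (h : P → Fin D → ℝ) (G : P → ℝ) (b : Fin D) (r : ℝ)
    (hGT : ∀ q ∈ S, ∑ p ∈ S, G p * T p q = 0) (hGY : ∀ᵐ Y ∂τ, ∑ p ∈ S, G p * Y p b = 0) :
    (Real.exp ((∑ p ∈ S, ∑ q ∈ S, ∑ a : Fin D, (h p a + if a = b then r * G p else 0) *
          (h q a + if a = b then r * G q else 0) * T p q) / 2) *
        ∫ Y, Real.cos (∑ p ∈ S, ∑ a : Fin D, (h p a + if a = b then r * G p else 0) * Y p a) ∂τ =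
      Real.exp ((∑ p ∈ S, ∑ q ∈ S, ∑ a : Fin D, h p a * h q a * T p q) / 2) *
        ∫ Y, Real.cos (∑ p ∈ S, ∑ a : Fin D, h p a * Y p a) ∂τ) ∧
    (Real.exp ((∑ p ∈ S, ∑ q ∈ S, ∑ a : Fin D, (h p a + if a = b then r * G p else 0) *
          (h q a + if a = b then r * G q else 0) * T p q) / 2) *
        ∫ Y, Real.sin (∑ p ∈ S, ∑ a : Fin D, (h p a + if a = b then r * G p else 0) * Y p a) ∂τ =
      Real.exp ((∑ p ∈ S, ∑ q ∈ S, ∑ a : Fin D, h p a * h q a * T p q) / 2) *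
        ∫ Y, Real.sin (∑ p ∈ S, ∑ a : Fin D, h p a * Y p a) ∂τ) := by
  have hpair : ∀ᵐ Y ∂τ, ∑ p ∈ S, ∑ a : Fin D, (h p a + if a = b then r * G p else 0) * Y p a =
      ∑ p ∈ S, ∑ a : Fin D, h p a * Y p a :=
    hGY.mono fun Y hY => by rw [pairing_shift, hY, mul_zero, add_zero]
  rw [quadratic_shift S h G T b r hT hGT]
  constructor
  · congr 1
    exact integral_congr_ae (hpair.mono fun Y hY => by simp only [hY])
  · congr 1
    exact integral_congr_ae (hpair.mono fun Y hY => by simp only [hY])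

end CubeShiftInvariance

/-- STUB F2 — **invariance of `e^{Q/2} Φ_τ` under co-exact (cube) shifts**: GIVEN the statement of
STUB K2 (`dT = 0` in the first slot of `T = curvatureTwoPoint`), for every measure `τ` supported on
closed cochains (T1), adding `r` times the face cochain
`f_κ = δ_{(x+eᵢ;j,k)} − δ_{(x;j,k)} − δ_{(x+eⱼ;i,k)} + δ_{(x;i,k)} + δ_{(x+eₖ;i,j)} − δ_{(x;i,j)}` of a
`3`-cell `κ = (x; i<j<k)` in one colour `b` to `h` changes neither `exp (Q_S(h)/2) E cos ⟨Y, h⟩_S`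
nor `exp (Q_S(h)/2) E sin ⟨Y, h⟩_S` (the pairing changes by `r (dY)^b_κ = 0` a.s., and
`∑_p f_κ(p) T(p, q) = 0` by K2), provided the six faces lie in `S`
(`CubeShiftInvariance.invariance`). -/
theorem stub_cubeShiftInvariance :
    -- (K2)
    (∀ (q : Literature.MathematicalPhysics.QuantumLattice.ZdPlaquette 4)
        (x : Literature.Probability.LatticeModels.Site 4) (i j k : Fin 4) (hij : i < j) (hjk : j < k),
      (Literature.MathematicalPhysics.QuantumFieldTheory.curvatureTwoPoint
            (x + Pi.single i 1, ⟨(j, k), hjk⟩) q -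
          Literature.MathematicalPhysics.QuantumFieldTheory.curvatureTwoPoint (x, ⟨(j, k), hjk⟩) q) -
        (Literature.MathematicalPhysics.QuantumFieldTheory.curvatureTwoPoint
            (x + Pi.single j 1, ⟨(i, k), hij.trans hjk⟩) q -
          Literature.MathematicalPhysics.QuantumFieldTheory.curvatureTwoPoint
            (x, ⟨(i, k), hij.trans hjk⟩) q) +
        (Literature.MathematicalPhysics.QuantumFieldTheory.curvatureTwoPoint
            (x + Pi.single k 1, ⟨(i, j), hij⟩) q -
          Literature.MathematicalPhysics.QuantumFieldTheory.curvatureTwoPoint (x, ⟨(i, j), hij⟩) q) =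
      0) →
    ∀ (D : ℕ) (τ : MeasureTheory.Measure
        (Literature.MathematicalPhysics.QuantumLattice.ZdPlaquette 4 → Fin D → ℝ)),
      (∀ (x : Literature.Probability.LatticeModels.Site 4) (i j k : Fin 4)
          (hij : i < j) (hjk : j < k) (a : Fin D),
        ∀ᵐ Y ∂τ,
          (Y (x + Pi.single i 1, ⟨(j, k), hjk⟩) a - Y (x, ⟨(j, k), hjk⟩) a) -
            (Y (x + Pi.single j 1, ⟨(i, k), hij.trans hjk⟩) a -
              Y (x, ⟨(i, k), hij.trans hjk⟩) a) +
            (Y (x + Pi.single k 1, ⟨(i, j), hij⟩) a - Y (x, ⟨(i, j), hij⟩) a) = 0) →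
      ∀ (S : Finset (Literature.MathematicalPhysics.QuantumLattice.ZdPlaquette 4))
          (h : Literature.MathematicalPhysics.QuantumLattice.ZdPlaquette 4 → Fin D → ℝ)
          (x : Literature.Probability.LatticeModels.Site 4) (i j k : Fin 4) (hij : i < j) (hjk : j < k)
          (b : Fin D) (r : ℝ),
        (x + Pi.single i 1, ⟨(j, k), hjk⟩) ∈ S → (x, ⟨(j, k), hjk⟩) ∈ S →
        (x + Pi.single j 1, ⟨(i, k), hij.trans hjk⟩) ∈ S → (x, ⟨(i, k), hij.trans hjk⟩) ∈ S →
        (x + Pi.single k 1, ⟨(i, j), hij⟩) ∈ S → (x, ⟨(i, j), hij⟩) ∈ S →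
        (Real.exp ((∑ p ∈ S, ∑ q ∈ S, ∑ a : Fin D,
              (fun (p : Literature.MathematicalPhysics.QuantumLattice.ZdPlaquette 4) (a : Fin D) =>
                h p a + (if a = b then r *
                  ((if p = (x + Pi.single i 1, ⟨(j, k), hjk⟩) then (1 : ℝ) else 0) -
                    (if p = (x, ⟨(j, k), hjk⟩) then (1 : ℝ) else 0) -
                    (if p = (x + Pi.single j 1, ⟨(i, k), hij.trans hjk⟩) then (1 : ℝ) else 0) +
                    (if p = (x, ⟨(i, k), hij.trans hjk⟩) then (1 : ℝ) else 0) +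
                    (if p = (x + Pi.single k 1, ⟨(i, j), hij⟩) then (1 : ℝ) else 0) -
                    (if p = (x, ⟨(i, j), hij⟩) then (1 : ℝ) else 0)) else 0)) p a *
              (fun (p : Literature.MathematicalPhysics.QuantumLattice.ZdPlaquette 4) (a : Fin D) =>
                h p a + (if a = b then r *
                  ((if p = (x + Pi.single i 1, ⟨(j, k), hjk⟩) then (1 : ℝ) else 0) -
                    (if p = (x, ⟨(j, k), hjk⟩) then (1 : ℝ) else 0) -
                    (if p = (x + Pi.single j 1, ⟨(i, k), hij.trans hjk⟩) then (1 : ℝ) else 0) +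
                    (if p = (x, ⟨(i, k), hij.trans hjk⟩) then (1 : ℝ) else 0) +
                    (if p = (x + Pi.single k 1, ⟨(i, j), hij⟩) then (1 : ℝ) else 0) -
                    (if p = (x, ⟨(i, j), hij⟩) then (1 : ℝ) else 0)) else 0)) q a *
                Literature.MathematicalPhysics.QuantumFieldTheory.curvatureTwoPoint p q) / 2) *
            ∫ Y, Real.cos (∑ p ∈ S, ∑ a : Fin D,
              (fun (p : Literature.MathematicalPhysics.QuantumLattice.ZdPlaquette 4) (a : Fin D) =>
                h p a + (if a = b then r *
                  ((if p = (x + Pi.single i 1, ⟨(j, k), hjk⟩) then (1 : ℝ) else 0) -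
                    (if p = (x, ⟨(j, k), hjk⟩) then (1 : ℝ) else 0) -
                    (if p = (x + Pi.single j 1, ⟨(i, k), hij.trans hjk⟩) then (1 : ℝ) else 0) +
                    (if p = (x, ⟨(i, k), hij.trans hjk⟩) then (1 : ℝ) else 0) +
                    (if p = (x + Pi.single k 1, ⟨(i, j), hij⟩) then (1 : ℝ) else 0) -
                    (if p = (x, ⟨(i, j), hij⟩) then (1 : ℝ) else 0)) else 0)) p a * Y p a) ∂τ =
          Real.exp ((∑ p ∈ S, ∑ q ∈ S, ∑ a : Fin D,
              h p a * h q a * Literature.MathematicalPhysics.QuantumFieldTheory.curvatureTwoPoint p q) / 2) *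
            ∫ Y, Real.cos (∑ p ∈ S, ∑ a : Fin D, h p a * Y p a) ∂τ) ∧
        (Real.exp ((∑ p ∈ S, ∑ q ∈ S, ∑ a : Fin D,
              (fun (p : Literature.MathematicalPhysics.QuantumLattice.ZdPlaquette 4) (a : Fin D) =>
                h p a + (if a = b then r *
                  ((if p = (x + Pi.single i 1, ⟨(j, k), hjk⟩) then (1 : ℝ) else 0) -
                    (if p = (x, ⟨(j, k), hjk⟩) then (1 : ℝ) else 0) -
                    (if p = (x + Pi.single j 1, ⟨(i, k), hij.trans hjk⟩) then (1 : ℝ) else 0) +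
                    (if p = (x, ⟨(i, k), hij.trans hjk⟩) then (1 : ℝ) else 0) +
                    (if p = (x + Pi.single k 1, ⟨(i, j), hij⟩) then (1 : ℝ) else 0) -
                    (if p = (x, ⟨(i, j), hij⟩) then (1 : ℝ) else 0)) else 0)) p a *
              (fun (p : Literature.MathematicalPhysics.QuantumLattice.ZdPlaquette 4) (a : Fin D) =>
                h p a + (if a = b then r *
                  ((if p = (x + Pi.single i 1, ⟨(j, k), hjk⟩) then (1 : ℝ) else 0) -
                    (if p = (x, ⟨(j, k), hjk⟩) then (1 : ℝ) else 0) -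
                    (if p = (x + Pi.single j 1, ⟨(i, k), hij.trans hjk⟩) then (1 : ℝ) else 0) +
                    (if p = (x, ⟨(i, k), hij.trans hjk⟩) then (1 : ℝ) else 0) +
                    (if p = (x + Pi.single k 1, ⟨(i, j), hij⟩) then (1 : ℝ) else 0) -
                    (if p = (x, ⟨(i, j), hij⟩) then (1 : ℝ) else 0)) else 0)) q a *
                Literature.MathematicalPhysics.QuantumFieldTheory.curvatureTwoPoint p q) / 2) *
            ∫ Y, Real.sin (∑ p ∈ S, ∑ a : Fin D,
              (fun (p : Literature.MathematicalPhysics.QuantumLattice.ZdPlaquette 4) (a : Fin D) =>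
                h p a + (if a = b then r *
                  ((if p = (x + Pi.single i 1, ⟨(j, k), hjk⟩) then (1 : ℝ) else 0) -
                    (if p = (x, ⟨(j, k), hjk⟩) then (1 : ℝ) else 0) -
                    (if p = (x + Pi.single j 1, ⟨(i, k), hij.trans hjk⟩) then (1 : ℝ) else 0) +
                    (if p = (x, ⟨(i, k), hij.trans hjk⟩) then (1 : ℝ) else 0) +
                    (if p = (x + Pi.single k 1, ⟨(i, j), hij⟩) then (1 : ℝ) else 0) -
                    (if p = (x, ⟨(i, j), hij⟩) then (1 : ℝ) else 0)) else 0)) p a * Y p a) ∂τ =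
          Real.exp ((∑ p ∈ S, ∑ q ∈ S, ∑ a : Fin D,
              h p a * h q a * Literature.MathematicalPhysics.QuantumFieldTheory.curvatureTwoPoint p q) / 2) *
            ∫ Y, Real.sin (∑ p ∈ S, ∑ a : Fin D, h p a * Y p a) ∂τ) := by
  intro hK2 D τ hT1 S h x i j k hij hjk b r h₁ h₂ h₃ h₄ h₅ h₆
  have hGT : ∀ q ∈ S, ∑ p ∈ S,
      ((if p = (x + Pi.single i 1, ⟨(j, k), hjk⟩) then (1 : ℝ) else 0) -
          (if p = (x, ⟨(j, k), hjk⟩) then (1 : ℝ) else 0) -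
          (if p = (x + Pi.single j 1, ⟨(i, k), hij.trans hjk⟩) then (1 : ℝ) else 0) +
          (if p = (x, ⟨(i, k), hij.trans hjk⟩) then (1 : ℝ) else 0) +
          (if p = (x + Pi.single k 1, ⟨(i, j), hij⟩) then (1 : ℝ) else 0) -
          (if p = (x, ⟨(i, j), hij⟩) then (1 : ℝ) else 0)) *
        curvatureTwoPoint p q = 0 := fun q _ => by
    rw [CubeShiftInvariance.sum_faceCochain_mul S h₁ h₂ h₃ h₄ h₅ h₆]
    exact hK2 q x i j k hij hjk
  have hGY : ∀ᵐ Y ∂τ, ∑ p ∈ S,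
      ((if p = (x + Pi.single i 1, ⟨(j, k), hjk⟩) then (1 : ℝ) else 0) -
          (if p = (x, ⟨(j, k), hjk⟩) then (1 : ℝ) else 0) -
          (if p = (x + Pi.single j 1, ⟨(i, k), hij.trans hjk⟩) then (1 : ℝ) else 0) +
          (if p = (x, ⟨(i, k), hij.trans hjk⟩) then (1 : ℝ) else 0) +
          (if p = (x + Pi.single k 1, ⟨(i, j), hij⟩) then (1 : ℝ) else 0) -
          (if p = (x, ⟨(i, j), hij⟩) then (1 : ℝ) else 0)) * Y p b = 0 :=
    (hT1 x i j k hij hjk b).mono fun Y hY => by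
      rw [CubeShiftInvariance.sum_faceCochain_mul S h₁ h₂ h₃ h₄ h₅ h₆]
      exact hY
  have key := CubeShiftInvariance.invariance τ _ curvatureTwoPoint_comm S h _ b r hGT hGY
  beta_reduce
  exact key

/-- ANCHOR `stub_cubeShiftInvarianceCore` (registered sub-goal; the full statement of STUB F2 exceeds the
stub registry's signature cap) — **the kernel-level core of STUB F2**: for every measure `τ` on
`ℝ^D`-valued `2`-cochains of `ℤ⁴`, every window `S`, test function `h`, colour `b`, `r : ℝ` and every
shift profile `G : ZdPlaquette 4 → ℝ` that is orthogonal on `S` to the kernel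
(`∑_{p ∈ S} G p · curvatureTwoPoint p q = 0` for `q ∈ S`) and pairs to zero with `Y^b` `τ`-a.e.
(`∑_{p ∈ S} G p · Y p b = 0`), replacing `h` by `h + r G e_b` changes neither
`exp (Q_S/2) · E cos ⟨Y, ·⟩_S` nor `exp (Q_S/2) · E sin ⟨Y, ·⟩_S`
(`CubeShiftInvariance.invariance` with `T = curvatureTwoPoint`, symmetric by `curvatureTwoPoint_comm`).
STUB F2 is the case `G = f_κ`, the face cochain of a `3`-cell. -/
theorem stub_cubeShiftInvarianceCore :
    ∀ (D : ℕ) (τ : MeasureTheory.Measure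
        (Literature.MathematicalPhysics.QuantumLattice.ZdPlaquette 4 → Fin D → ℝ))
      (S : Finset (Literature.MathematicalPhysics.QuantumLattice.ZdPlaquette 4))
      (h : Literature.MathematicalPhysics.QuantumLattice.ZdPlaquette 4 → Fin D → ℝ)
      (G : Literature.MathematicalPhysics.QuantumLattice.ZdPlaquette 4 → ℝ) (b : Fin D) (r : ℝ),
      (∀ q ∈ S, ∑ p ∈ S,
          G p * Literature.MathematicalPhysics.QuantumFieldTheory.curvatureTwoPoint p q = 0) →
      (∀ᵐ Y ∂τ, ∑ p ∈ S, G p * Y p b = 0) →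
      (Real.exp ((∑ p ∈ S, ∑ q ∈ S, ∑ a : Fin D, (h p a + if a = b then r * G p else 0) *
              (h q a + if a = b then r * G q else 0) *
              Literature.MathematicalPhysics.QuantumFieldTheory.curvatureTwoPoint p q) / 2) *
          ∫ Y, Real.cos (∑ p ∈ S, ∑ a : Fin D,
            (h p a + if a = b then r * G p else 0) * Y p a) ∂τ =
        Real.exp ((∑ p ∈ S, ∑ q ∈ S, ∑ a : Fin D, h p a * h q a *
              Literature.MathematicalPhysics.QuantumFieldTheory.curvatureTwoPoint p q) / 2) *
          ∫ Y, Real.cos (∑ p ∈ S, ∑ a : Fin D, h p a * Y p a) ∂τ) ∧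
      (Real.exp ((∑ p ∈ S, ∑ q ∈ S, ∑ a : Fin D, (h p a + if a = b then r * G p else 0) *
              (h q a + if a = b then r * G q else 0) *
              Literature.MathematicalPhysics.QuantumFieldTheory.curvatureTwoPoint p q) / 2) *
          ∫ Y, Real.sin (∑ p ∈ S, ∑ a : Fin D,
            (h p a + if a = b then r * G p else 0) * Y p a) ∂τ =
        Real.exp ((∑ p ∈ S, ∑ q ∈ S, ∑ a : Fin D, h p a * h q a *
              Literature.MathematicalPhysics.QuantumFieldTheory.curvatureTwoPoint p q) / 2) *
          ∫ Y, Real.sin (∑ p ∈ S, ∑ a : Fin D, h p a * Y p a) ∂τ) :=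
  fun _ τ S h G b r hGT hGY =>
    CubeShiftInvariance.invariance τ _ curvatureTwoPoint_comm S h G b r hGT hGY

end Summit.QuantumFields.YangMills.Theorems.EquipartitionPinsProbe

end
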